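/-
Copyright (c) 2026 the pub-hodgecm-mathlib formalisation cell (harness21).  Prover seat hodgecm-mathlib-K2Liu-p01 (g6), Track B «K2-LIT»,
Road I organ (A-int)-fin, the (A4-avg) brick (LEAD F0P6-plan (g12) 08:01:01Z ∕ RULING M-157a (4); co-dealer K2E5-plan (g6) 08:00:52Z).  KERNEL: theorems only.
-/
import Summits.HodgeConjecture.HodgeConjecture.Theorems.K2LiuDoublingSchrodingerModelDefs   -- ★ β-1 `swSectionDelta`, `LocalMpDelta`
import Summits.HodgeConjecture.HodgeConjecture.Theorems.F0LD1OrbitAverageFixed            -- ★ `apply_out_mk_eq`, `apply_orbitAverage_eq`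
import Literature.RepresentationTheory.HeisenbergGroup.SchrodingerLeraySectionSmooth       -- ★ `apply_sub_self_mem_piPrimePowBall`, `near_symm_of_near`
import Mathlib.Topology.Algebra.OpenSubgroup
import HarnessLib

/-!
# Crux `HLiu418`, Track B road `K2_Liu`, Road I organ (A-int)-fin — the (A4-avg) brick: THE FINITE `K′`-AVERAGE, `f^Δ_{π′Φ} = f^Δ_Φ`

Cell `hodgecm-mathlib`, crux item hLiu418 = `stmt-HodgeConjecture-24832`, route of record `HCCMUnconditional`; squad K2 ∕ K2Liu, prover K2Liu-p01 (g6).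
THEOREMS ONLY (no `def`, no instance, no notation, no named fact, no `sorry`); lane `--supports stmt-HodgeConjecture-24832 --as helper`.

WHAT U5 STEP 0 («WLOG `Φ_f` is `K′_f`-invariant», SIGS (K′-conv)) and every (A4″-K) consumer read BY NAME.  NO new definition: the finite `K′`-average
`π′Φ` IS the ★ `F0LD1OrbitAverageFixed` expression `(card (Γ ⧸ S))⁻¹ • Σ_{q : Γ ⧸ S} π q.out Φ` over an (open, finite-index) stabiliser `S` of `Φ` (★
`apply_orbitAverage_eq`: it is `Γ`-fixed).  This file adds:
* §1 (generic, characteristic `0`) `orbitAverage_eq_self` (identity on invariants), **`map_orbitAverage_eq`** (a `Γ`-invariant linear map sees the average as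
  `x` — THE mechanism), `orbitAverage_add ∕ _smul ∕ _mem_span`, LEVEL INDEPENDENCE `orbitAverage_eq_orbitAverage(_of_le)` (so `π′` is well defined and linear by
  value), `exists_subgroup_mem_iff` (the stabiliser as a subgroup);
* §2 (generic topological group) `isOpen_setOf_apply_eq_self`, `exists_isOpen_subgroup_mem_iff`, `exists_isOpen_subgroup_finite_quotient` (compact `Γ`);
* §3 (SMOOTHNESS of the linear action on `𝒮(F^ι)`, [MVW] II.8) `leviOp_eq_self_of_near` (`[a] ≡ 1 (mod 𝔭^k)` fixes a `Φ` supported in `(𝔭^M)^ι` and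
  `(𝔭^N)^ι`-periodic once `k ≥ 1`, `N ≤ k + M`), `eventually_near_one`, **`eventually_leviOp_eq_self`** (`ρ : Γ →* GL(F^ι)` pointwise continuous),
  `isOpen_setOf_leviOp_eq_self`, `exists_isOpen_subgroup_leviOp_iff`, `exists_isOpen_subgroup_finite_quotient_leviOp`, `leviEquivSB_eq_self_iff`;
* §4 (the SW section of ★ β-1) **`swSectionDelta_toRep_eq_mul_of_commute`** (`p` commuting with `sΔ(H)`, `(ω^Δ(p)Ψ)(0) = c·Ψ(0)` ⇒ `f^Δ_{ω^Δ(p)Φ} = c · f^Δ_Φ`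
  — the character is EXPLICIT: «WLOG `K′`-invariant» needs `K′ ⊆ ker χ′`), `swSectionDelta_toRep_eq(_mul)_of_leviEquivSB` (the A2c∕A2d junction shape),
  **`swSectionDelta_orbitAverage_eq`** (`f^Δ_{π′Φ} = f^Δ_Φ` whenever `f^Δ` is `π`-invariant) and the package **`exists_fixed_swSectionDelta_eq`** (compact `Γ`
  acting through `s` by `leviEquivSB (ρ γ)` commuting with `sΔ(H)`: a `Γ`-FIXED `Φ′` in the span of the orbit with `f^Δ_{Φ′} = f^Δ_Φ`).

HONEST LABEL: HC_CM is proved only modulo the printed citations (2 remaining named inputs: hLiu418 = stmt-HodgeConjecture-24832, h413 = stmt-HodgeConjecture-24833)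
until rung 0 closes; helper, closes no item.
References: [BernsteinZelevinsky1976] §2; [MoeglinVignerasWaldspurger1987] Chap. 2 II.6, II.8; [KudlaRallis1994] §1; [Kudla1994] §3 Thm. 3.1; [GanQiuTakeda2014] §2.7–2.8.
-/

set_option autoImplicit false
set_option linter.dupNamespace false -- the mandated namespace repeats `HodgeConjecture.HodgeConjecture`
noncomputable section

open Matrix Topology Filter
open NumberField IsDedekindDomain
open Literature.NumberTheory.GaloisRepresentations.IsNonarchimedeanLocalField
open Literature.NumberTheory.Automorphic Literature.RepresentationTheory.HeisenbergGroup
open Literature.NumberTheory.GelbartRogawski1991 Literature.NumberTheory.GelbartRogawski1991.GRConstruction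
open Literature.NumberTheory.GelbartRogawski1991.UnitaryDualPair.LocalSplitting
open Summit.HodgeConjecture.HodgeConjecture.Cruxes.HLiu418.F0LD1OrbitAverageFixed
open Summit.HodgeConjecture.HodgeConjecture.Cruxes.HLiu418.K2LiuDoublingSchrodingerModelDefs

namespace Summit.HodgeConjecture.HodgeConjecture.Cruxes.HLiu418.K2LiuSWSectionKPrimeAverage

/-! ## §1 Finite orbit averages (generic linear algebra) -/

section Average

variable {k : Type*} [Field k] {Γ : Type*} [Group Γ] {V W : Type*} [AddCommGroup V] [Module k V] [AddCommGroup W] [Module k W]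
  (ρ : Representation k Γ V)

/-- the index of a subgroup with finite quotient is a non-zero scalar in characteristic `0`. [folklore] -/
theorem cast_card_quotient_ne_zero [CharZero k] (S : Subgroup Γ) [Fintype (Γ ⧸ S)] : (Fintype.card (Γ ⧸ S) : k) ≠ 0 :=
  Nat.cast_ne_zero.2 (Fintype.card_pos_iff.2 ⟨((1 : Γ) : Γ ⧸ S)⟩).ne'

/-- **the orbit average is the identity on invariants**: `(card Γ⧸S)⁻¹ • Σ_q ρ(q̃) x = x` when `Γ` fixes `x`. [cite: BernsteinZelevinsky1976, §2] -/
theorem orbitAverage_eq_self [CharZero k] (S : Subgroup Γ) [Fintype (Γ ⧸ S)] {x : V} (hx : ∀ γ : Γ, ρ γ x = x) :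
    ((Fintype.card (Γ ⧸ S) : k)⁻¹) • ∑ q : Γ ⧸ S, ρ q.out x = x := by
  simp_rw [hx]
  rw [Finset.sum_const, Finset.card_univ, ← Nat.cast_smul_eq_nsmul k, smul_smul, inv_mul_cancel₀ (cast_card_quotient_ne_zero S), one_smul]

/-- **A `Γ`-INVARIANT LINEAR MAP SEES THE ORBIT AVERAGE AS `x`**: if `ℓ (ρ γ x) = ℓ x` for all `γ`, then `ℓ ((card Γ⧸S)⁻¹ • Σ_q ρ(q̃) x) = ℓ x` —
the mechanism behind «`f_{π′Φ} = f_Φ`». [cite: BernsteinZelevinsky1976, §2] [cite: GanQiuTakeda2014, §2.8] -/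
theorem map_orbitAverage_eq [CharZero k] (S : Subgroup Γ) [Fintype (Γ ⧸ S)] (ℓ : V →ₗ[k] W) {x : V} (hℓ : ∀ γ : Γ, ℓ (ρ γ x) = ℓ x) :
    ℓ (((Fintype.card (Γ ⧸ S) : k)⁻¹) • ∑ q : Γ ⧸ S, ρ q.out x) = ℓ x := by
  rw [map_smul, map_sum]
  simp_rw [hℓ]
  rw [Finset.sum_const, Finset.card_univ, ← Nat.cast_smul_eq_nsmul k, smul_smul, inv_mul_cancel₀ (cast_card_quotient_ne_zero S), one_smul]

/-- the (scaled) orbit sum is additive in the vector (same level `S`). [cite: BernsteinZelevinsky1976, §2] -/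
theorem orbitAverage_add (S : Subgroup Γ) [Fintype (Γ ⧸ S)] (c : k) (x y : V) :
    c • ∑ q : Γ ⧸ S, ρ q.out (x + y) = c • ∑ q : Γ ⧸ S, ρ q.out x + c • ∑ q : Γ ⧸ S, ρ q.out y := by
  simp_rw [map_add]
  rw [Finset.sum_add_distrib, smul_add]

/-- the (scaled) orbit sum is homogeneous in the vector (same level `S`). [cite: BernsteinZelevinsky1976, §2] -/
theorem orbitAverage_smul (S : Subgroup Γ) [Fintype (Γ ⧸ S)] (c a : k) (x : V) :
    c • ∑ q : Γ ⧸ S, ρ q.out (a • x) = a • (c • ∑ q : Γ ⧸ S, ρ q.out x) := by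
  simp_rw [map_smul]
  rw [← Finset.smul_sum, smul_comm]

/-- the (scaled) orbit sum lies in the span of the orbit. [cite: BernsteinZelevinsky1976, §2] -/
theorem orbitAverage_mem_span (S : Subgroup Γ) [Fintype (Γ ⧸ S)] (c : k) (x : V) :
    c • ∑ q : Γ ⧸ S, ρ q.out x ∈ Submodule.span k (Set.range fun γ : Γ => ρ γ x) :=
  Submodule.smul_mem _ c (Submodule.sum_mem _ fun q _ => Submodule.subset_span ⟨q.out, rfl⟩)

/-- **LEVEL INDEPENDENCE**: for `S′ ≤ S` of finite index with `S` fixing `x`, the averages over `Γ ⧸ S′` and over `Γ ⧸ S` agree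
(`Γ ⧸ S′ ≃ (Γ ⧸ S) × (S ⧸ S′)`, and the summand only depends on the image in `Γ ⧸ S`). [cite: BernsteinZelevinsky1976, §2] -/
theorem orbitAverage_eq_orbitAverage_of_le [CharZero k] {S' S : Subgroup Γ} (hle : S' ≤ S) [Fintype (Γ ⧸ S)] [Fintype (Γ ⧸ S')] {x : V}
    (hS : ∀ s ∈ S, ρ s x = x) :
    ((Fintype.card (Γ ⧸ S') : k)⁻¹) • ∑ q : Γ ⧸ S', ρ q.out x = ((Fintype.card (Γ ⧸ S) : k)⁻¹) • ∑ q : Γ ⧸ S, ρ q.out x := by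
  classical
  have hS' : ∀ s ∈ S', ρ s x = x := fun s hs => hS s (hle hs)
  haveI : Finite (S ⧸ S'.subgroupOf S) :=
    Finite.of_injective (fun r => (Subgroup.quotientEquivProdOfLE hle).symm (((1 : Γ) : Γ ⧸ S), r))
      fun r₁ r₂ h => (Prod.ext_iff.1 ((Subgroup.quotientEquivProdOfLE hle).symm.injective h)).2
  letI : Fintype (S ⧸ S'.subgroupOf S) := Fintype.ofFinite _
  have hterm : ∀ q : Γ ⧸ S', ρ q.out x = ρ (Subgroup.quotientEquivProdOfLE hle q).1.out x := by
    intro q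
    induction q using QuotientGroup.induction_on with
    | H g =>
      rw [apply_out_mk_eq ρ S' hS' g]
      exact (apply_out_mk_eq ρ S hS g).symm
  have hcard : Fintype.card (Γ ⧸ S') = Fintype.card (S ⧸ S'.subgroupOf S) * Fintype.card (Γ ⧸ S) := by
    rw [Fintype.card_congr (Subgroup.quotientEquivProdOfLE hle), Fintype.card_prod, mul_comm]
  simp_rw [hterm]
  rw [Fintype.sum_equiv (Subgroup.quotientEquivProdOfLE hle) (fun q => ρ (Subgroup.quotientEquivProdOfLE hle q).1.out x)
    (fun p => ρ p.1.out x) (fun _ => rfl), Fintype.sum_prod_type]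
  simp only [Finset.sum_const, Finset.card_univ]
  rw [← Finset.smul_sum, hcard, Nat.cast_mul, _root_.mul_inv_rev, ← Nat.cast_smul_eq_nsmul k (Fintype.card (S ⧸ S'.subgroupOf S)), smul_smul,
    inv_mul_cancel_right₀ (cast_card_quotient_ne_zero (k := k) (S'.subgroupOf S))]

/-- **the average does not depend on the fixing subgroup**: two finite-index subgroups fixing `x` give the same average (pass to `S₁ ⊓ S₂`).
[cite: BernsteinZelevinsky1976, §2] -/
theorem orbitAverage_eq_orbitAverage [CharZero k] {S₁ S₂ : Subgroup Γ} [Fintype (Γ ⧸ S₁)] [Fintype (Γ ⧸ S₂)] {x : V}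
    (h₁ : ∀ s ∈ S₁, ρ s x = x) (h₂ : ∀ s ∈ S₂, ρ s x = x) :
    ((Fintype.card (Γ ⧸ S₁) : k)⁻¹) • ∑ q : Γ ⧸ S₁, ρ q.out x = ((Fintype.card (Γ ⧸ S₂) : k)⁻¹) • ∑ q : Γ ⧸ S₂, ρ q.out x := by
  haveI : S₁.FiniteIndex := Subgroup.finiteIndex_of_finite_quotient
  haveI : S₂.FiniteIndex := Subgroup.finiteIndex_of_finite_quotient
  letI : Fintype (Γ ⧸ (S₁ ⊓ S₂)) := Fintype.ofFinite _
  rw [← orbitAverage_eq_orbitAverage_of_le ρ (inf_le_left : S₁ ⊓ S₂ ≤ S₁) h₁, orbitAverage_eq_orbitAverage_of_le ρ (inf_le_right : S₁ ⊓ S₂ ≤ S₂) h₂]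

omit [Field k] [AddCommGroup V] [Module k V] in
/-- **the stabiliser of a vector is a subgroup** (existence with its membership criterion; no definition is introduced). [folklore] -/
theorem exists_subgroup_mem_iff {k : Type*} [CommSemiring k] {V : Type*} [AddCommMonoid V] [Module k V] (ρ : Representation k Γ V) (x : V) :
    ∃ S : Subgroup Γ, ∀ γ, γ ∈ S ↔ ρ γ x = x := by
  refine ⟨{ carrier := {γ | ρ γ x = x}, mul_mem' := ?_, one_mem' := ?_, inv_mem' := ?_ }, fun γ => Iff.rfl⟩
  · intro a b ha hb
    simp only [Set.mem_setOf_eq] at ha hb ⊢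
    rw [map_mul, Module.End.mul_apply, hb, ha]
  · simp only [Set.mem_setOf_eq, map_one, Module.End.one_apply]
  · intro a ha
    simp only [Set.mem_setOf_eq] at ha ⊢
    calc ρ a⁻¹ x = ρ a⁻¹ (ρ a x) := by rw [ha]
      _ = x := by rw [← Module.End.mul_apply, ← map_mul, inv_mul_cancel, map_one, Module.End.one_apply]

end Average

/-! ## §2 Open stabilisers (generic topological group) -/

section Stabiliser

variable {k : Type*} [CommSemiring k] {Γ : Type*} [Group Γ] [TopologicalSpace Γ] [IsTopologicalGroup Γ] {V : Type*} [AddCommMonoid V] [Module k V]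
  (ρ : Representation k Γ V)

/-- **a stabiliser containing a neighbourhood of `1` is open** (translate the neighbourhood). [cite: BernsteinZelevinsky1976, §2] -/
theorem isOpen_setOf_apply_eq_self (x : V) {U : Set Γ} (hU : U ∈ 𝓝 (1 : Γ)) (hUx : ∀ γ ∈ U, ρ γ x = x) :
    IsOpen {γ : Γ | ρ γ x = x} := by
  rw [isOpen_iff_mem_nhds]
  intro γ₀ hγ₀
  have hγ₀' : ρ γ₀ x = x := hγ₀
  have hU' : (fun γ : Γ => γ₀⁻¹ * γ) ⁻¹' U ∈ 𝓝 γ₀ :=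
    (continuous_const_mul γ₀⁻¹).continuousAt.preimage_mem_nhds (by rwa [inv_mul_cancel])
  refine Filter.mem_of_superset hU' fun γ hγ => ?_
  have h1 : ρ γ x = ρ γ₀ (ρ (γ₀⁻¹ * γ) x) := by rw [← Module.End.mul_apply, ← map_mul, mul_inv_cancel_left]
  show ρ γ x = x
  rw [h1, hUx _ hγ, hγ₀']

/-- **an open stabilising subgroup**: if `ρ γ x = x` on a neighbourhood of `1`, the stabiliser of `x` is an OPEN subgroup. [cite: BernsteinZelevinsky1976, §2] -/
theorem exists_isOpen_subgroup_mem_iff (x : V) {U : Set Γ} (hU : U ∈ 𝓝 (1 : Γ)) (hUx : ∀ γ ∈ U, ρ γ x = x) :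
    ∃ S : Subgroup Γ, IsOpen (S : Set Γ) ∧ ∀ γ, γ ∈ S ↔ ρ γ x = x := by
  obtain ⟨S, hS⟩ := exists_subgroup_mem_iff ρ x
  have hSeq : (S : Set Γ) = {γ | ρ γ x = x} := Set.ext hS
  exact ⟨S, hSeq ▸ isOpen_setOf_apply_eq_self ρ x hU hUx, hS⟩

/-- **… of finite index when `Γ` is compact**: the orbit of a smooth vector under a compact group is finite. [cite: BernsteinZelevinsky1976, §2] -/
theorem exists_isOpen_subgroup_finite_quotient [CompactSpace Γ] (x : V) {U : Set Γ} (hU : U ∈ 𝓝 (1 : Γ)) (hUx : ∀ γ ∈ U, ρ γ x = x) :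
    ∃ S : Subgroup Γ, IsOpen (S : Set Γ) ∧ Finite (Γ ⧸ S) ∧ ∀ γ, γ ∈ S ↔ ρ γ x = x := by
  obtain ⟨S, hSo, hS⟩ := exists_isOpen_subgroup_mem_iff ρ x hU hUx
  exact ⟨S, hSo, Subgroup.quotient_finite_of_isOpen S hSo, hS⟩

end Stabiliser

/-! ## §3 Smoothness of the linear action on `𝒮(F^ι)` -/

section Smooth

variable {F : Type*} [Field F] [ValuativeRel F] [TopologicalSpace F] [IsNonarchimedeanLocalField F]
  {ι : Type*} [Fintype ι] [DecidableEq ι]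

/-- **`Φ ∘ a⁻¹ = Φ` for `[a] ≡ 1 (mod 𝔭^k)`** (boxes): `Φ` supported in `(𝔭^M)^ι` and `(𝔭^N)^ι`-periodic, `k ≥ 1`, `N ≤ k + M` ⇒ `leviOp a Φ = Φ` (★ `near_symm_of_near`,
★ `apply_sub_self_mem_piPrimePowBall`, ★ `apply_mem_piPrimePowBall_of_near`). [cite: MoeglinVignerasWaldspurger1987, Chap. 2 II.8] [cite: Weil1964, n° 11] -/
theorem leviOp_eq_self_of_near (a : (ι → F) ≃ₗ[F] (ι → F)) {Φ : (ι → F) → ℂ} {M N k : ℤ}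
    (hsupp : ∀ u ∉ piPrimePowBall F ι M, Φ u = 0) (hper : ∀ x, ∀ t ∈ piPrimePowBall F ι N, Φ (x + t) = Φ x)
    (hk : 1 ≤ k) (hN : N ≤ k + M) (ha : ∀ i j, (LinearMap.toMatrix' (a : (ι → F) →ₗ[F] (ι → F)) - 1) i j ∈ primePowBall F k) :
    leviOp a Φ = Φ := by
  have ha' := near_symm_of_near hk a ha
  funext u
  rw [leviOp_apply]
  by_cases hu : u ∈ piPrimePowBall F ι M
  · have h1 : a.symm u - u ∈ piPrimePowBall F ι N := by
      have h := apply_sub_self_mem_piPrimePowBall (a.symm : (ι → F) →ₗ[F] (ι → F)) ha' hu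
      rw [LinearEquiv.coe_coe] at h
      exact piPrimePowBall_antitone hN h
    have h2 := hper u _ h1
    rwa [add_sub_cancel] at h2
  · have hu' : a.symm u ∉ piPrimePowBall F ι M := fun h => hu (by
      have h' := apply_mem_piPrimePowBall_of_near (by omega : (0 : ℤ) ≤ k) (a : (ι → F) →ₗ[F] (ι → F)) ha h
      rwa [LinearEquiv.coe_coe, LinearEquiv.apply_symm_apply] at h')
    rw [hsupp _ hu', hsupp u hu]

variable {Γ : Type*} [Group Γ] [TopologicalSpace Γ]

/-- **`[ρ γ] ≡ 1 (mod 𝔭^k)` near `1`** for a pointwise-continuous `ρ : Γ →* GL(F^ι)` (the `(i, j)` entry of `[ρ γ] − 1` is the `i`-th coordinate of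
`ρ γ e_j − e_j`, continuous in `γ`, `0` at `γ = 1`; `𝔭^k` is open). [cite: MoeglinVignerasWaldspurger1987, Chap. 2 II.8] -/
theorem eventually_near_one (ρ : Γ →* ((ι → F) ≃ₗ[F] (ι → F))) (hρ : ∀ u, Continuous fun γ => ρ γ u) (k : ℤ) :
    ∀ᶠ γ in 𝓝 (1 : Γ), ∀ i j, (LinearMap.toMatrix' (ρ γ : (ι → F) →ₗ[F] (ι → F)) - 1) i j ∈ primePowBall F k := by
  simp only [Filter.eventually_all]
  intro i j
  have hc : Continuous fun γ => ((ρ γ (Pi.single j (1 : F)) : ι → F) - (Pi.single j (1 : F) : ι → F)) i :=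
    (continuous_apply i).comp ((hρ (Pi.single j (1 : F))).sub continuous_const)
  have hmem : primePowBall F k ∈ 𝓝 ((fun γ => ((ρ γ (Pi.single j (1 : F)) : ι → F) - (Pi.single j (1 : F) : ι → F)) i) 1) := by
    refine (isOpen_primePowBall k).mem_nhds ?_
    simp only [map_one, LinearEquiv.coe_one, id_eq, sub_self, Pi.zero_apply]
    exact zero_mem_primePowBall k
  refine Filter.mem_of_superset (hc.continuousAt.preimage_mem_nhds hmem) fun γ hγ => ?_
  rw [Set.mem_preimage] at hγ
  show (LinearMap.toMatrix' (ρ γ : (ι → F) →ₗ[F] (ι → F)) - 1) i j ∈ primePowBall F k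
  rw [Matrix.sub_apply, LinearMap.toMatrix'_apply, LinearEquiv.coe_coe, Matrix.one_apply]
  rwa [Pi.sub_apply, Pi.single_apply] at hγ

/-- **THE LINEAR ACTION ON `𝒮(F^ι)` IS SMOOTH**: for a pointwise-continuous `ρ : Γ →* GL(F^ι)` and `Φ ∈ 𝒮(F^ι)`, `leviOp (ρ γ) Φ = Φ` for all `γ` near `1`
(support box ★ `exists_eq_zero_of_notMem_piPrimePowBall`, period box ★ `exists_forall_add_eq_of_mem_schwartzBruhat_pi`). [cite: MoeglinVignerasWaldspurger1987, Chap. 2 II.8] -/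
theorem eventually_leviOp_eq_self (ρ : Γ →* ((ι → F) ≃ₗ[F] (ι → F))) (hρ : ∀ u, Continuous fun γ => ρ γ u) (Φ : SchwartzBruhat (ι → F)) :
    ∀ᶠ γ in 𝓝 (1 : Γ), leviOp (ρ γ) (Φ : (ι → F) → ℂ) = Φ := by
  obtain ⟨M, hM⟩ := exists_eq_zero_of_notMem_piPrimePowBall Φ.2
  obtain ⟨N, hN⟩ := exists_forall_add_eq_of_mem_schwartzBruhat_pi Φ.2
  filter_upwards [eventually_near_one ρ hρ (max 1 (N - M))] with γ hγ
  exact leviOp_eq_self_of_near (ρ γ) hM hN (le_max_left _ _) (by omega) hγ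

variable [IsTopologicalGroup Γ]

/-- **the stabiliser `{γ ∣ Φ ∘ (ρ γ)⁻¹ = Φ}` is open**. [cite: MoeglinVignerasWaldspurger1987, Chap. 2 II.8] [cite: BernsteinZelevinsky1976, §2] -/
theorem isOpen_setOf_leviOp_eq_self (ρ : Γ →* ((ι → F) ≃ₗ[F] (ι → F))) (hρ : ∀ u, Continuous fun γ => ρ γ u) (Φ : SchwartzBruhat (ι → F)) :
    IsOpen {γ : Γ | leviOp (ρ γ) (Φ : (ι → F) → ℂ) = Φ} := by
  rw [isOpen_iff_mem_nhds]
  intro γ₀ hγ₀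
  have hγ₀' : leviOp (ρ γ₀) (Φ : (ι → F) → ℂ) = Φ := hγ₀
  have hU' : (fun γ : Γ => γ₀⁻¹ * γ) ⁻¹' {γ : Γ | leviOp (ρ γ) (Φ : (ι → F) → ℂ) = Φ} ∈ 𝓝 γ₀ :=
    (continuous_const_mul γ₀⁻¹).continuousAt.preimage_mem_nhds (by rw [inv_mul_cancel]; exact eventually_leviOp_eq_self ρ hρ Φ)
  refine Filter.mem_of_superset hU' fun γ hγ => ?_
  have hγ' : leviOp (ρ (γ₀⁻¹ * γ)) (Φ : (ι → F) → ℂ) = Φ := hγ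
  show leviOp (ρ γ) (Φ : (ι → F) → ℂ) = Φ
  rw [← mul_inv_cancel_left γ₀ γ, map_mul, leviOp_mul, LinearEquiv.mul_apply, hγ', hγ₀']

/-- **an open stabilising subgroup for the linear action on `𝒮(F^ι)`**. [cite: MoeglinVignerasWaldspurger1987, Chap. 2 II.8] [cite: BernsteinZelevinsky1976, §2] -/
theorem exists_isOpen_subgroup_leviOp_iff (ρ : Γ →* ((ι → F) ≃ₗ[F] (ι → F))) (hρ : ∀ u, Continuous fun γ => ρ γ u) (Φ : SchwartzBruhat (ι → F)) :
    ∃ S : Subgroup Γ, IsOpen (S : Set Γ) ∧ ∀ γ, γ ∈ S ↔ leviOp (ρ γ) (Φ : (ι → F) → ℂ) = Φ := by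
  have hone : ∀ f : (ι → F) → ℂ, leviOp (1 : (ι → F) ≃ₗ[F] (ι → F)) f = f := fun f => by rw [leviOp_one]; rfl
  refine ⟨{ carrier := {γ | leviOp (ρ γ) (Φ : (ι → F) → ℂ) = Φ}, mul_mem' := ?_, one_mem' := ?_, inv_mem' := ?_ }, ?_, fun γ => Iff.rfl⟩
  · intro a b ha hb
    simp only [Set.mem_setOf_eq] at ha hb ⊢
    rw [map_mul, leviOp_mul, LinearEquiv.mul_apply, hb, ha]
  · simp only [Set.mem_setOf_eq, map_one, hone]
  · intro a ha
    simp only [Set.mem_setOf_eq] at ha ⊢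
    calc leviOp (ρ a⁻¹) (Φ : (ι → F) → ℂ) = leviOp (ρ a⁻¹) (leviOp (ρ a) (Φ : (ι → F) → ℂ)) := by rw [ha]
      _ = Φ := by rw [← LinearEquiv.mul_apply, ← leviOp_mul, ← map_mul, inv_mul_cancel, map_one, hone]
  · exact isOpen_setOf_leviOp_eq_self ρ hρ Φ

/-- **… of finite index when `Γ` is compact**: the orbit `{Φ ∘ (ρ γ)⁻¹}` under a compact group is FINITE. [cite: MoeglinVignerasWaldspurger1987, Chap. 2 II.8] -/
theorem exists_isOpen_subgroup_finite_quotient_leviOp [CompactSpace Γ] (ρ : Γ →* ((ι → F) ≃ₗ[F] (ι → F))) (hρ : ∀ u, Continuous fun γ => ρ γ u)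
    (Φ : SchwartzBruhat (ι → F)) :
    ∃ S : Subgroup Γ, IsOpen (S : Set Γ) ∧ Finite (Γ ⧸ S) ∧ ∀ γ, γ ∈ S ↔ leviOp (ρ γ) (Φ : (ι → F) → ℂ) = Φ := by
  obtain ⟨S, hSo, hS⟩ := exists_isOpen_subgroup_leviOp_iff ρ hρ Φ
  exact ⟨S, hSo, Subgroup.quotient_finite_of_isOpen S hSo, hS⟩

omit [ValuativeRel F] [TopologicalSpace F] [IsNonarchimedeanLocalField F] [Fintype ι] [DecidableEq ι] [IsTopologicalGroup Γ] in
/-- `leviEquivSB a Φ = Φ` in `𝒮` iff `leviOp a Φ = Φ` on functions (dictionary for consumers holding the `𝒮`-valued operator). [cite: Weil1964, n° 13] -/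
theorem leviEquivSB_eq_self_iff {X : Type*} [AddCommGroup X] [Module F X] [TopologicalSpace X] (a : X ≃ₗ[F] X) (ha : Continuous a)
    (ha' : Continuous a.symm) (Φ : SchwartzBruhat X) : leviEquivSB a ha ha' Φ = Φ ↔ leviOp a (Φ : X → ℂ) = Φ := by
  rw [Subtype.ext_iff, coe_leviEquivSB]

end Smooth

/-! ## §4 The Siegel–Weil section of ★ β-1 under commuting operators and under the finite average -/

section SW

variable (L : Type) [Field L] [NumberField L] [IsCMField L]
variable {N M n : ℕ} (e : Fin N × Fin M ≃ Fin n)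
  (dV : Fin N → L) (hdV : ∀ i, IsCMField.complexConj L (dV i) = dV i)
  (dW : Fin M → L) (hdW : ∀ i, IsCMField.complexConj L (dW i) = dW i)
  {Nd : ℕ} {J : Matrix (Fin Nd) (Fin Nd) L} (v : HeightOneSpectrum (𝓞 (Fp L)))
  (sΔ : UnitaryGroup.localPi L (IsCMField.complexConj L) Nd J v →* LocalMpDelta L e dV hdV dW hdW v)

/-- **`f^Δ_{ω^Δ(p)Φ}(h) = c · f^Δ_Φ(h)` FOR `p` COMMUTING WITH `s^Δ(H)`** whose operator multiplies the value at `0` by `c` (e.g. `p` over `1_ℓ ⊗ g`, `g ∈ U(V′_w)`,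
acting by `χ′(g) • leviOp`); the character `c` is EXPLICIT: `K′`-invariance passes to `f^Δ` only for `K′ ⊆ ker χ′`. [cite: KudlaRallis1994, §1] [cite: Kudla1994, §3 Thm. 3.1] -/
theorem swSectionDelta_toRep_eq_mul_of_commute (p : LocalMpDelta L e dV hdV dW hdW v) (c : ℂ)
    (hp0 : ∀ Ψ : SchwartzBruhat (Fin (n + n) → v.adicCompletion (Fp L)),
      ((MpPsi.toRep (localSchrodingerDelta L e dV hdV dW hdW v) p Ψ : SchwartzBruhat (Fin (n + n) → v.adicCompletion (Fp L))) :
        (Fin (n + n) → v.adicCompletion (Fp L)) → ℂ) 0 = c * (Ψ : (Fin (n + n) → v.adicCompletion (Fp L)) → ℂ) 0)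
    (hcomm : ∀ h, Commute p (sΔ h)) (Φ : SchwartzBruhat (Fin (n + n) → v.adicCompletion (Fp L)))
    (h : UnitaryGroup.localPi L (IsCMField.complexConj L) Nd J v) :
    swSectionDelta L e dV hdV dW hdW v sΔ (MpPsi.toRep (localSchrodingerDelta L e dV hdV dW hdW v) p Φ) h =
      c * swSectionDelta L e dV hdV dW hdW v sΔ Φ h := by
  have key : MpPsi.toRep (localSchrodingerDelta L e dV hdV dW hdW v) (sΔ h) * MpPsi.toRep (localSchrodingerDelta L e dV hdV dW hdW v) p =
      MpPsi.toRep (localSchrodingerDelta L e dV hdV dW hdW v) p * MpPsi.toRep (localSchrodingerDelta L e dV hdV dW hdW v) (sΔ h) :=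
    ((map_mul (MpPsi.toRep (localSchrodingerDelta L e dV hdV dW hdW v)) (sΔ h) p).symm.trans
      (congrArg (MpPsi.toRep (localSchrodingerDelta L e dV hdV dW hdW v)) (hcomm h).eq.symm)).trans
      (map_mul (MpPsi.toRep (localSchrodingerDelta L e dV hdV dW hdW v)) p (sΔ h))
  have h3 : MpPsi.toRep (localSchrodingerDelta L e dV hdV dW hdW v) (sΔ h) (MpPsi.toRep (localSchrodingerDelta L e dV hdV dW hdW v) p Φ) =
      MpPsi.toRep (localSchrodingerDelta L e dV hdV dW hdW v) p (MpPsi.toRep (localSchrodingerDelta L e dV hdV dW hdW v) (sΔ h) Φ) :=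
    (Module.End.mul_apply _ _ _).symm.trans ((LinearMap.congr_fun key Φ).trans (Module.End.mul_apply _ _ _))
  exact (congrArg (fun F : SchwartzBruhat (Fin (n + n) → v.adicCompletion (Fp L)) => (F : (Fin (n + n) → v.adicCompletion (Fp L)) → ℂ) 0) h3).trans
    (hp0 (MpPsi.toRep (localSchrodingerDelta L e dV hdV dW hdW v) (sΔ h) Φ))

/-- **… for a splitting acting by `χ′(g) • leviEquivSB (ρ g)`** (the ★ A2c∕A2d junction shape): `f^Δ_{ω^Δ(s g)Φ}(h) = χ′(g) · f^Δ_Φ(h)` whenever `s(g)` commutes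
with `s^Δ(H)` — `U(V′_w)` acts LINEARLY and fixes `0 ∈ X_Δ`. [cite: Kudla1994, §3 Thm. 3.1] [cite: KudlaRallis1994, §1] -/
theorem swSectionDelta_toRep_eq_mul_of_leviEquivSB {G : Type*} [Group G] (s : G →* LocalMpDelta L e dV hdV dW hdW v)
    (ρ : G →* ((Fin (n + n) → v.adicCompletion (Fp L)) ≃ₗ[v.adicCompletion (Fp L)] (Fin (n + n) → v.adicCompletion (Fp L))))
    (hc : ∀ g, Continuous (ρ g)) (hc' : ∀ g, Continuous (ρ g).symm) (χ : G →* ℂˣ)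
    (hχ : ∀ (g : G) (f : SchwartzBruhat (Fin (n + n) → v.adicCompletion (Fp L))),
      MpPsi.toRep (localSchrodingerDelta L e dV hdV dW hdW v) (s g) f = (χ g : ℂ) • leviEquivSB (ρ g) (hc g) (hc' g) f)
    (hcomm : ∀ g h, Commute (s g) (sΔ h)) (g : G) (Φ : SchwartzBruhat (Fin (n + n) → v.adicCompletion (Fp L)))
    (h : UnitaryGroup.localPi L (IsCMField.complexConj L) Nd J v) :
    swSectionDelta L e dV hdV dW hdW v sΔ (MpPsi.toRep (localSchrodingerDelta L e dV hdV dW hdW v) (s g) Φ) h =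
      (χ g : ℂ) * swSectionDelta L e dV hdV dW hdW v sΔ Φ h :=
  swSectionDelta_toRep_eq_mul_of_commute L e dV hdV dW hdW v sΔ (s g) (χ g : ℂ)
    (fun Ψ => by rw [hχ g Ψ, Submodule.coe_smul, Pi.smul_apply, coe_leviEquivSB, leviOp_apply, map_zero, smul_eq_mul]) (hcomm g) Φ h

/-- **… character `1`**: `f^Δ_{ω^Δ(s g)Φ} = f^Δ_Φ` when `s(g)` acts by `leviEquivSB (ρ g)` and commutes with `s^Δ(H)`. [cite: Kudla1994, §3 Thm. 3.1] -/
theorem swSectionDelta_toRep_eq_of_leviEquivSB {G : Type*} [Group G] (s : G →* LocalMpDelta L e dV hdV dW hdW v)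
    (ρ : G →* ((Fin (n + n) → v.adicCompletion (Fp L)) ≃ₗ[v.adicCompletion (Fp L)] (Fin (n + n) → v.adicCompletion (Fp L))))
    (hc : ∀ g, Continuous (ρ g)) (hc' : ∀ g, Continuous (ρ g).symm)
    (hs : ∀ (g : G) (f : SchwartzBruhat (Fin (n + n) → v.adicCompletion (Fp L))),
      MpPsi.toRep (localSchrodingerDelta L e dV hdV dW hdW v) (s g) f = leviEquivSB (ρ g) (hc g) (hc' g) f)
    (hcomm : ∀ g h, Commute (s g) (sΔ h)) (g : G) (Φ : SchwartzBruhat (Fin (n + n) → v.adicCompletion (Fp L)))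
    (h : UnitaryGroup.localPi L (IsCMField.complexConj L) Nd J v) :
    swSectionDelta L e dV hdV dW hdW v sΔ (MpPsi.toRep (localSchrodingerDelta L e dV hdV dW hdW v) (s g) Φ) h =
      swSectionDelta L e dV hdV dW hdW v sΔ Φ h := by
  exact (swSectionDelta_toRep_eq_mul_of_commute L e dV hdV dW hdW v sΔ (s g) 1
    (fun Ψ => by rw [hs g Ψ, coe_leviEquivSB, leviOp_apply, map_zero, one_mul]) (hcomm g) Φ h).trans (one_mul _)

/-- **THE (A4-avg) BRICK `f^Δ_{π′Φ} = f^Δ_Φ`**: for any representation `π` of `Γ` on `𝒮(X_Δ)` under which the section is invariant (`f^Δ_{π γ Φ} = f^Δ_Φ`), the finite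
average `π′Φ = (card Γ⧸S)⁻¹ • Σ_q π(q̃) Φ` has the same Siegel–Weil section (★ `swSectionDelta_add ∕ _smul` make `Φ ↦ f^Δ_Φ(h)` linear; §1 `map_orbitAverage_eq`).
[cite: GanQiuTakeda2014, §2.8] [cite: KudlaRallis1994, §1] -/
theorem swSectionDelta_orbitAverage_eq {Γ : Type*} [Group Γ] (π : Representation ℂ Γ (SchwartzBruhat (Fin (n + n) → v.adicCompletion (Fp L))))
    (S : Subgroup Γ) [Fintype (Γ ⧸ S)] (Φ : SchwartzBruhat (Fin (n + n) → v.adicCompletion (Fp L)))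
    (hπ : ∀ (γ : Γ) (h : UnitaryGroup.localPi L (IsCMField.complexConj L) Nd J v),
      swSectionDelta L e dV hdV dW hdW v sΔ (π γ Φ) h = swSectionDelta L e dV hdV dW hdW v sΔ Φ h)
    (h : UnitaryGroup.localPi L (IsCMField.complexConj L) Nd J v) :
    swSectionDelta L e dV hdV dW hdW v sΔ (((Fintype.card (Γ ⧸ S) : ℂ)⁻¹) • ∑ q : Γ ⧸ S, π q.out Φ) h = swSectionDelta L e dV hdV dW hdW v sΔ Φ h := by
  let ℓ : SchwartzBruhat (Fin (n + n) → v.adicCompletion (Fp L)) →ₗ[ℂ] ℂ :=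
    { toFun := fun Ψ => swSectionDelta L e dV hdV dW hdW v sΔ Ψ h
      map_add' := fun Ψ Ψ' => swSectionDelta_add L e dV hdV dW hdW v sΔ Ψ Ψ' h
      map_smul' := fun a Ψ => swSectionDelta_smul L e dV hdV dW hdW v sΔ a Ψ h }
  have hℓ : ∀ γ : Γ, ℓ (π γ Φ) = ℓ Φ := fun γ => by
    simp only [ℓ, LinearMap.coe_mk, AddHom.coe_mk]
    exact hπ γ h
  have key := map_orbitAverage_eq π S ℓ hℓ
  simp only [ℓ, LinearMap.coe_mk, AddHom.coe_mk] at key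
  exact key

/-- **PACKAGED «WLOG `Φ` IS `K′`-INVARIANT»**: let a COMPACT group `Γ` (e.g. `K′ ⊆ ker χ′` compact open in `U(V′_w)`) act on `𝒮(X_Δ)` through a splitting `s` by the
LINEAR operators `leviEquivSB (ρ γ)` (character `1`), `ρ` pointwise continuous, each `s γ` commuting with `s^Δ(H)`.  Then every `Φ` has a `Γ`-FIXED `Φ′` (its finite
average) in the span of its orbit with THE SAME Siegel–Weil section. [cite: GanQiuTakeda2014, §2.7–2.8] [cite: MoeglinVignerasWaldspurger1987, Chap. 2 II.8] -/
theorem exists_fixed_swSectionDelta_eq {Γ : Type*} [Group Γ] [TopologicalSpace Γ] [IsTopologicalGroup Γ] [CompactSpace Γ]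
    (s : Γ →* LocalMpDelta L e dV hdV dW hdW v)
    (ρ : Γ →* ((Fin (n + n) → v.adicCompletion (Fp L)) ≃ₗ[v.adicCompletion (Fp L)] (Fin (n + n) → v.adicCompletion (Fp L))))
    (hρ : ∀ u, Continuous fun γ => ρ γ u) (hc : ∀ γ, Continuous (ρ γ)) (hc' : ∀ γ, Continuous (ρ γ).symm)
    (hs : ∀ (γ : Γ) (f : SchwartzBruhat (Fin (n + n) → v.adicCompletion (Fp L))),
      MpPsi.toRep (localSchrodingerDelta L e dV hdV dW hdW v) (s γ) f = leviEquivSB (ρ γ) (hc γ) (hc' γ) f)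
    (hcomm : ∀ γ h, Commute (s γ) (sΔ h)) (Φ : SchwartzBruhat (Fin (n + n) → v.adicCompletion (Fp L))) :
    ∃ Φ' : SchwartzBruhat (Fin (n + n) → v.adicCompletion (Fp L)),
      (∀ γ : Γ, MpPsi.toRep (localSchrodingerDelta L e dV hdV dW hdW v) (s γ) Φ' = Φ') ∧
      (∀ h, swSectionDelta L e dV hdV dW hdW v sΔ Φ' h = swSectionDelta L e dV hdV dW hdW v sΔ Φ h) ∧
      Φ' ∈ Submodule.span ℂ (Set.range fun γ : Γ => MpPsi.toRep (localSchrodingerDelta L e dV hdV dW hdW v) (s γ) Φ) := by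
  have hx := exists_isOpen_subgroup_finite_quotient_leviOp ρ hρ Φ
  obtain ⟨S, -, hSf, hS⟩ := hx
  letI : Fintype (Γ ⧸ S) := Fintype.ofFinite _
  let π : Representation ℂ Γ (SchwartzBruhat (Fin (n + n) → v.adicCompletion (Fp L))) := (MpPsi.toRep (localSchrodingerDelta L e dV hdV dW hdW v)).comp s
  have hπ : ∀ (γ : Γ) (Ψ : SchwartzBruhat (Fin (n + n) → v.adicCompletion (Fp L))),
      π γ Ψ = MpPsi.toRep (localSchrodingerDelta L e dV hdV dW hdW v) (s γ) Ψ := fun _ _ => rfl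
  have hSπ : ∀ γ ∈ S, π γ Φ = Φ := fun γ hγ => by
    rw [hπ, hs, leviEquivSB_eq_self_iff]
    exact (hS γ).1 hγ
  have hinv : ∀ (γ : Γ) (h' : UnitaryGroup.localPi L (IsCMField.complexConj L) Nd J v),
      swSectionDelta L e dV hdV dW hdW v sΔ (π γ Φ) h' = swSectionDelta L e dV hdV dW hdW v sΔ Φ h' := fun γ h' => by
    rw [hπ]
    exact swSectionDelta_toRep_eq_of_leviEquivSB L e dV hdV dW hdW v sΔ s ρ hc hc' hs hcomm γ Φ h'
  refine ⟨((Fintype.card (Γ ⧸ S) : ℂ)⁻¹) • ∑ q : Γ ⧸ S, π q.out Φ, fun γ => ?_, fun h => swSectionDelta_orbitAverage_eq L e dV hdV dW hdW v sΔ π S Φ hinv h, ?_⟩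
  · rw [← hπ]
    exact apply_orbitAverage_eq π S hSπ _ γ
  · simp_rw [← hπ]
    exact orbitAverage_mem_span π S _ Φ

end SW

end Summit.HodgeConjecture.HodgeConjecture.Cruxes.HLiu418.K2LiuSWSectionKPrimeAverage
end
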